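import Summits.AtomisticToContinuum.BoseEinsteinCondensation.Theses.BECPhaseQuadratureSumRule
import Summits.AtomisticToContinuum.BoseEinsteinCondensation.Theorems.BECHusimiAmplitudeGasPositivityReductionStability
import HarnessLib

/-!
# Route BECPhaseQuadratureSumRule — `CouplingContinuity` (item stmt-AtomisticToContinuum-12626)

At fixed particle number `N` and side `L > 0`, for a smooth-class pair potential `v` and the coupling
family `w_t = t·v`, `t ∈ [0,1]`, the constant-mode occupation `n₀` of the exact minimisers of the
periodic `N`-body energy `-∑Δ + t∑v^per` is uniformly continuous in `t`:
`∀ ε > 0 ∃ δ > 0`, minimisers `Ψ` at `t` and `Ψ'` at `t'` with `|t - t'| < δ` satisfy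
`n₀(Ψ) ≤ n₀(Ψ') + εN`
(`Summit.AtomisticToContinuum.BoseEinsteinCondensation.Theses.BECPhaseQuadratureSumRule.CouplingContinuity`).

## Proof (no analytic perturbation theory is needed)

* **Lipschitz dependence of the energies on the coupling.** The smooth class gives a bounded profile
  of finite range, so `W = ∑_{i<j} v^per(xᵢ - xⱼ) ≤ B := N²C` and, for every trial state `Φ`,
  `E_{s v}(Φ) ≤ E_{t v}(Φ) + |s - t|·B`, hence `E₀(s) ≤ E₀(t) + |s - t|·B`
  (`periodicEnergy_coupling_le`, `periodicGroundStateEnergy_coupling_le`): a minimiser at coupling `t`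
  is a `2|s - t|B`-near-minimiser at coupling `s` (`periodicEnergy_le_of_minimiser_coupling`).
* **Two near-minimisers at a fixed coupling have close condensate occupations** — the tree's
  `condensateOccupation_le_of_nearMinimisers` (variational simplicity of the bosonic torus ground
  state of the bounded potential `s·v`, `PeriodicGroundStateNondegenerate_holds`, Reed–Simon IV
  §XIII.12; gap inequality, phase alignment, `2N`-Lipschitz `n₀`): `∃ δ_s > 0`, any two
  `δ_s`-near-minimisers at `s` satisfy `n₀(Ψ) ≤ n₀(Ψ') + εN`. No minimiser at `s` is needed.
* **Compactness of `[0,1]`.** With `r_s = δ_s / (2B + 2)`, minimisers at any couplings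
  `t, t' ∈ (s - r_s, s + r_s)` are `δ_s`-near-minimisers at `s`; the Lebesgue number of the open cover
  `{(s - r_s, s + r_s)}` of `[0,1]` (`lebesgue_number_lemma_of_metric`) is the sought `δ`.

The profile is symmetrised (`u(r) = v(|r|)`, same periodisation since `v^per` only evaluates `v` at
norms) so that the boundedness hypothesis of `condensateOccupation_le_of_nearMinimisers` holds on all
of `ℝ`.

## References

* M. Reed, B. Simon, *Methods of Modern Mathematical Physics IV*, Academic Press (1978): Thm XIII.1
  (min–max), §XIII.12 (nondegenerate ground states). [ReedSimonIV1978]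
* T. Kato, *Perturbation Theory for Linear Operators*, Springer (1966), Ch. VII §3 (the analytic
  statement of which this continuity statement is a weak form). [Kato1966]
-/

noncomputable section

open MeasureTheory Filter Set Complex Metric
open scoped ENNReal NNReal Topology

namespace Summit.AtomisticToContinuum.BoseEinsteinCondensation.Theorems

open Literature.MathematicalPhysics.QuantumManyBody Literature.MathematicalPhysics.QuantumManyBody.BoseGas

/-! ### The energies are Lipschitz in the coupling -/

section Coupling

variable {N : ℕ} {L : ℝ}

/-- The periodic energy at coupling `a`: `E_{a v}(Ψ) = ∫|∇Ψ|² + a ∫ W_v |Ψ|²`. [folklore] -/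
theorem periodicEnergy_const_mul (a : ℝ≥0∞) {v : ℝ → ℝ≥0∞} (hv : Measurable v)
    (Ψ : PeriodicTrialState N L) :
    periodicEnergy (fun r => a * v r) Ψ =
      (∫⁻ X in cellN N L, kineticDensity Ψ.ψ X) +
        a * ∫⁻ X in cellN N L, periodicInteraction v L X * (‖Ψ.ψ X‖₊ : ℝ≥0∞) ^ 2 := by
  unfold periodicEnergy
  have hf : Measurable fun X => periodicInteraction v L X * (‖Ψ.ψ X‖₊ : ℝ≥0∞) ^ 2 :=
    (measurable_periodicInteraction hv L).mul (measurable_normSq Ψ.contDiff.continuous)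
  rw [lintegral_add_left (measurable_kineticDensity Ψ.contDiff), ← lintegral_const_mul a hf]
  congr 1
  refine lintegral_congr fun X => ?_
  -- homogeneity of the periodisation and of the interaction in the profile
  rw [show periodicInteraction (fun r => a * v r) L X = a * periodicInteraction v L X by
      simp only [periodicInteraction, periodizedPotential, ENNReal.tsum_mul_left, Finset.mul_sum],
    mul_assoc]

/-- **The energy is Lipschitz in the coupling**: if `W_v ≤ B` pointwise then for every trial state
`E_{s v}(Ψ) ≤ E_{t v}(Ψ) + |s - t| B` (couplings entered as `ENNReal.ofReal`). [folklore] -/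
theorem periodicEnergy_coupling_le {v : ℝ → ℝ≥0∞} (hv : Measurable v) {B : ℝ≥0∞}
    (hB : ∀ X : Config N, periodicInteraction v L X ≤ B) (s t : ℝ) (Ψ : PeriodicTrialState N L) :
    periodicEnergy (fun r => ENNReal.ofReal s * v r) Ψ ≤
      periodicEnergy (fun r => ENNReal.ofReal t * v r) Ψ + ENNReal.ofReal |s - t| * B := by
  rw [periodicEnergy_const_mul _ hv, periodicEnergy_const_mul _ hv]
  set K := ∫⁻ X in cellN N L, kineticDensity Ψ.ψ X
  set I := ∫⁻ X in cellN N L, periodicInteraction v L X * (‖Ψ.ψ X‖₊ : ℝ≥0∞) ^ 2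
  have hI : I ≤ B := by
    calc I ≤ ∫⁻ X in cellN N L, B * (‖Ψ.ψ X‖₊ : ℝ≥0∞) ^ 2 :=
          lintegral_mono fun X => mul_le_mul' (hB X) le_rfl
      _ = B := by
          rw [lintegral_const_mul _ (measurable_normSq Ψ.contDiff.continuous), Ψ.norm_eq, mul_one]
  have hst : ENNReal.ofReal s ≤ ENNReal.ofReal t + ENNReal.ofReal |s - t| := by
    calc ENNReal.ofReal s ≤ ENNReal.ofReal (t + |s - t|) :=
          ENNReal.ofReal_le_ofReal (by linarith [le_abs_self (s - t)])
      _ ≤ ENNReal.ofReal t + ENNReal.ofReal |s - t| := ENNReal.ofReal_add_le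
  calc K + ENNReal.ofReal s * I ≤ K + (ENNReal.ofReal t + ENNReal.ofReal |s - t|) * I := by gcongr
    _ = K + ENNReal.ofReal t * I + ENNReal.ofReal |s - t| * I := by rw [add_mul, add_assoc]
    _ ≤ K + ENNReal.ofReal t * I + ENNReal.ofReal |s - t| * B := by gcongr

/-- **The ground-state energy is Lipschitz in the coupling**: `E₀(s v) ≤ E₀(t v) + |s - t| B`.
[folklore] -/
theorem periodicGroundStateEnergy_coupling_le {v : ℝ → ℝ≥0∞} (hv : Measurable v) {B : ℝ≥0∞}
    (hB : ∀ X : Config N, periodicInteraction v L X ≤ B) (s t : ℝ) :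
    periodicGroundStateEnergy (fun r => ENNReal.ofReal s * v r) N L ≤
      periodicGroundStateEnergy (fun r => ENNReal.ofReal t * v r) N L + ENNReal.ofReal |s - t| * B := by
  unfold periodicGroundStateEnergy
  rw [ENNReal.iInf_add]
  exact iInf_mono fun Ψ => periodicEnergy_coupling_le hv hB s t Ψ

/-- **A minimiser at coupling `t` is a `2|s - t|B`-near-minimiser at coupling `s`.** [folklore] -/
theorem periodicEnergy_le_of_minimiser_coupling {v : ℝ → ℝ≥0∞} (hv : Measurable v) {B : ℝ≥0∞}
    (hB : ∀ X : Config N, periodicInteraction v L X ≤ B) (s t : ℝ) (Ψ : PeriodicTrialState N L)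
    (hΨ : periodicEnergy (fun r => ENNReal.ofReal t * v r) Ψ =
      periodicGroundStateEnergy (fun r => ENNReal.ofReal t * v r) N L) :
    periodicEnergy (fun r => ENNReal.ofReal s * v r) Ψ ≤
      periodicGroundStateEnergy (fun r => ENNReal.ofReal s * v r) N L +
        2 * (ENNReal.ofReal |s - t| * B) := by
  calc periodicEnergy (fun r => ENNReal.ofReal s * v r) Ψ
      ≤ periodicEnergy (fun r => ENNReal.ofReal t * v r) Ψ + ENNReal.ofReal |s - t| * B :=
        periodicEnergy_coupling_le hv hB s t Ψ
    _ = periodicGroundStateEnergy (fun r => ENNReal.ofReal t * v r) N L + ENNReal.ofReal |s - t| * B := by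
        rw [hΨ]
    _ ≤ periodicGroundStateEnergy (fun r => ENNReal.ofReal s * v r) N L + ENNReal.ofReal |t - s| * B +
          ENNReal.ofReal |s - t| * B := by
        gcongr
        exact periodicGroundStateEnergy_coupling_le hv hB t s
    _ = periodicGroundStateEnergy (fun r => ENNReal.ofReal s * v r) N L +
          2 * (ENNReal.ofReal |s - t| * B) := by
        rw [abs_sub_comm, two_mul, add_assoc]

/-- The periodisation only evaluates the profile at norms (`v^per = u^per` for `u(r) = v(|r|)`), so
the periodic energies of `a·v` and `a·u` coincide. [folklore] -/
theorem periodicEnergy_const_mul_abs (a : ℝ≥0∞) (v : ℝ → ℝ≥0∞) (Ψ : PeriodicTrialState N L) :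
    periodicEnergy (fun r => a * v r) Ψ = periodicEnergy (fun r => a * v |r|) Ψ := by
  unfold periodicEnergy periodicInteraction periodizedPotential
  simp only [abs_norm]

/-- And so do the periodic ground-state energies of `a·v` and `a·u`. [folklore] -/
theorem periodicGroundStateEnergy_const_mul_abs (a : ℝ≥0∞) (v : ℝ → ℝ≥0∞) (N : ℕ) (L : ℝ) :
    periodicGroundStateEnergy (fun r => a * v r) N L =
      periodicGroundStateEnergy (fun r => a * v |r|) N L := by
  unfold periodicGroundStateEnergy
  exact iInf_congr fun Ψ => periodicEnergy_const_mul_abs a v Ψ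

end Coupling

/-! ### The theorem -/

/-- **`CouplingContinuity` (route `BECPhaseQuadratureSumRule`, item stmt-AtomisticToContinuum-12626),
proved.** For a smooth-class potential `v` (repulsive, finite range, finite, `C²` as `x ↦ v(|x|)`),
`N`, `L > 0` and `ε > 0` there is `δ > 0` such that for all couplings `t, t' ∈ [0,1]` with
`|t - t'| < δ` every exact minimiser `Ψ` of the periodic energy of `t·v` and every exact minimiser `Ψ'`
of that of `t'·v` satisfy `n₀(Ψ) ≤ n₀(Ψ') + εN`. Proof: the energies are `N²C`-Lipschitz in the
coupling (`periodicEnergy_le_of_minimiser_coupling`), so minimisers at couplings within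
`r_s = δ_s/(2N²C + 2)` of `s` are `δ_s`-near-minimisers at `s`, where `δ_s` is the tolerance of
`condensateOccupation_le_of_nearMinimisers` for the bounded potential `s·v` (variational simplicity of
the bosonic torus ground state, `PeriodicGroundStateNondegenerate_holds`); the Lebesgue number of the
open cover `{(s - r_s, s + r_s)}` of the compact `[0,1]` is `δ`.
[cite: ReedSimonIV1978, Thm. XIII.1 and §XIII.12 Thms XIII.43–XIII.46] -/
theorem couplingContinuity_proof : Theses.BECPhaseQuadratureSumRule.CouplingContinuity := by
  intro v hv hfin hC2 _hedge N L hL ε hε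
  obtain ⟨hmeas, R₀, hR₀⟩ := hv
  -- the smooth class is bounded on `ℝ³`
  obtain ⟨M, hM⟩ := exists_bound_of_continuous_finiteRange hfin hC2.continuous hR₀
  -- the symmetrised profile `u r = v |r|`: measurable, bounded on `ℝ`, finite range
  have hu_meas : Measurable fun r : ℝ => v |r| := hmeas.comp continuous_abs.measurable
  have huM : ∀ r : ℝ, v |r| ≤ M := fun r => by
    have h := hM (EuclideanSpace.single 0 r)
    have hn : ‖EuclideanSpace.single (0 : Fin 3) r‖ = |r| := by
      rw [EuclideanSpace.norm_eq]
      simp [Real.sqrt_sq_eq_abs]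
    rwa [hn] at h
  have huR : ∀ r : ℝ, R₀ < r → v |r| = 0 := fun r hr => hR₀ _ (hr.trans_le (le_abs_self r))
  -- bounded periodisation and bounded interaction `W_u ≤ Br = N²C`
  obtain ⟨C, hC⟩ := exists_bound_periodizedPotential hL huM huR
  set Br : ℝ := ((N * N : ℕ) : ℝ) * (C : ℝ) with hBr
  have hBr0 : 0 ≤ Br := by positivity
  have hB : ∀ X : Config N, periodicInteraction (fun r => v |r|) L X ≤ ENNReal.ofReal Br := by
    intro X
    refine (periodicInteraction_le_of_bound (C := (C : ℝ≥0∞)) hC X).trans (le_of_eq ?_)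
    rw [hBr, ENNReal.ofReal_mul (Nat.cast_nonneg _), ENNReal.ofReal_natCast, ENNReal.ofReal_coe_nnreal]
  -- local control of minimisers around every coupling `s`
  have hloc : ∀ s : ℝ, ∃ r : ℝ, 0 < r ∧ ∀ t t' : ℝ, |t - s| < r → |t' - s| < r →
      ∀ Ψ Ψ' : PeriodicTrialState N L,
        periodicEnergy (fun x => ENNReal.ofReal t * v x) Ψ =
          periodicGroundStateEnergy (fun x => ENNReal.ofReal t * v x) N L →
        periodicEnergy (fun x => ENNReal.ofReal t' * v x) Ψ' =
          periodicGroundStateEnergy (fun x => ENNReal.ofReal t' * v x) N L →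
        condensateOccupation N L Ψ.ψ ≤ condensateOccupation N L Ψ'.ψ + ENNReal.ofReal (ε * N) := by
    intro s
    -- the bounded potential `s·u` at coupling `s`
    have hus_meas : Measurable fun r : ℝ => ENNReal.ofReal s * v |r| := hu_meas.const_mul _
    have husR : ∀ r : ℝ, R₀ < r → ENNReal.ofReal s * v |r| = 0 := fun r hr => by
      rw [huR r hr, mul_zero]
    have husM : ∀ r : ℝ, ENNReal.ofReal s * v |r| ≤ ((ENNReal.ofReal s).toNNReal * M : ℝ≥0) :=
      fun r => by
        rw [ENNReal.coe_mul, ENNReal.coe_toNNReal ENNReal.ofReal_ne_top]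
        exact mul_le_mul' le_rfl (huM r)
    -- two near-minimisers at coupling `s` have close condensate occupations
    obtain ⟨δ, hδ0, hδ⟩ := condensateOccupation_le_of_nearMinimisers hus_meas husR husM N hL hε
    obtain ⟨δ', hδ'0, hδ'⟩ : ∃ δ' : ℝ, 0 < δ' ∧ ENNReal.ofReal δ' ≤ δ := by
      obtain ⟨q, _, hq1, hq2⟩ := ENNReal.lt_iff_exists_real_btwn.1 hδ0
      exact ⟨q, ENNReal.ofReal_pos.1 hq1, hq2.le⟩
    -- the radius
    set r : ℝ := δ' / (2 * Br + 2) with hr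
    have hr0 : 0 < r := by positivity
    have hr2 : 2 * (r * Br) + 2 * r = δ' := by
      rw [hr]
      field_simp
    -- minimisers at couplings within `r` of `s` are `δ`-near-minimisers at `s`
    have hnear : ∀ (τ : ℝ) (Φ : PeriodicTrialState N L), |τ - s| < r →
        periodicEnergy (fun x => ENNReal.ofReal τ * v x) Φ =
          periodicGroundStateEnergy (fun x => ENNReal.ofReal τ * v x) N L →
        periodicEnergy (fun x => ENNReal.ofReal s * v |x|) Φ ≤
          periodicGroundStateEnergy (fun x => ENNReal.ofReal s * v |x|) N L + δ := by
      intro τ Φ hτ hΦ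
      rw [periodicEnergy_const_mul_abs (ENNReal.ofReal τ) v Φ,
        periodicGroundStateEnergy_const_mul_abs (ENNReal.ofReal τ) v N L] at hΦ
      refine (periodicEnergy_le_of_minimiser_coupling hu_meas hB s τ Φ hΦ).trans
        (add_le_add le_rfl ?_)
      rw [show (2 : ℝ≥0∞) * (ENNReal.ofReal |s - τ| * ENNReal.ofReal Br) =
          ENNReal.ofReal (2 * (|s - τ| * Br)) by
        rw [← ENNReal.ofReal_mul (abs_nonneg _), ENNReal.ofReal_mul zero_le_two, ENNReal.ofReal_ofNat]]
      refine (ENNReal.ofReal_le_ofReal ?_).trans hδ'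
      have hτ' : |s - τ| ≤ r := by
        rw [abs_sub_comm]
        exact hτ.le
      have h1 : |s - τ| * Br ≤ r * Br := mul_le_mul_of_nonneg_right hτ' hBr0
      linarith
    exact ⟨r, hr0, fun t t' hts ht's Ψ Ψ' hΨ hΨ' =>
      hδ Ψ Ψ' (hnear t Ψ hts hΨ) (hnear t' Ψ' ht's hΨ')⟩
  -- the Lebesgue number of the cover of `[0,1]` by the windows `(s - r_s, s + r_s)`
  choose r hr0 hr using hloc
  obtain ⟨δ, hδ0, hδ⟩ := lebesgue_number_lemma_of_metric (isCompact_Icc (a := (0 : ℝ)) (b := 1))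
    (c := fun s => ball s (r s)) (fun _ => isOpen_ball)
    (fun x _ => mem_iUnion.2 ⟨x, mem_ball_self (hr0 x)⟩)
  refine ⟨δ, hδ0, fun t t' ht0 ht1 _ _ htt' Ψ Ψ' => ?_⟩
  intro w w' hΨ _ hΨ' _
  obtain ⟨s, hs⟩ := hδ t ⟨ht0, ht1⟩
  have hts : |t - s| < r s := by
    have h := hs (mem_ball_self hδ0)
    rwa [mem_ball, Real.dist_eq] at h
  have ht's : |t' - s| < r s := by
    have h' : t' ∈ ball t δ := by
      rw [mem_ball, Real.dist_eq, abs_sub_comm]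
      exact htt'
    have h := hs h'
    rwa [mem_ball, Real.dist_eq] at h
  exact hr s t t' hts ht's Ψ Ψ' hΨ hΨ'

end Summit.AtomisticToContinuum.BoseEinsteinCondensation.Theorems

end
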